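import Summits.CriticalPhenomena.PercolationContinuityZ3.Theorems.PercNearOneGluingNoHeavyQuantFarTreeBlockCombStrong
import HarnessLib

/-!
# QUANT lane R8, FAR on trees beyond block-combs: SIDE STRUCTURES in gate coordinates — the mixing identity

builds on p205010 (kernel theorem, internal audit signed; external expert review pending)

Support file (`--supports stmt-CriticalPhenomena-4575`), QUANT lane typer seat prim-quant-stmt (gen 16); census-1 g13's transport ask
(lane INBOX 2026-08-21T05:12Z (ii): "identify `P(#reached ≥ j+1)` of 'presentation + one hair/cherry at chain vertex `ch l`' with the
3-term combination by gate splits, pattern of `BlockCombGate.real_heavy_eq_tail`").  Theorems only (the `local notation3` of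
`…QuantBlockCombMergeModel.lean`, verbatim), no definitions, no sorries, standard axioms.

Setting of `…QuantFarTreeBlockCombStrong.lean` (p1 g8): independent gates `q : E → [0,1]`, an injective chain `ch : Fin D → E`, blobs `k : κ`
with pairwise disjoint private gate sets `G k` off the chain, levels `lv k ≤ D`, sizes `a k`; blob `k` is REACHED when the chain prefix of
length `lv k` and all of `G k` are open.  A SIDE STRUCTURE at chain level `l` is any finite set `X` of further gates (off the chain and the
blobs) with a count `c : Set E → ℕ` of the relays it carries, depending on the configuration only through the gates of `X`; it contributes
`c ω` relays when the chain prefix of length `l` is open (hairs, cherries, any finite subtree hanging at a chain vertex).  In the canonical model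
it is book-kept by a SPARE index `u` (`G u = ∅`, `a u = 0`, `lv u = l`): a sure blob whose size is set to the side count.

* `Quant.BlockCombGate.sum_update_spare` — book-keeping of the spare index.
* `Quant.BlockCombGate.real_heavy_side_eq_sum` — **THE MIXING IDENTITY**:
  `P(Σ_{k reached} a k + [prefix l open]·c ω ≥ j+1) = Σ_{U ⊆ X} (∏_{e∈X} q e^{[e∈U]} (1 − q e)^{[e∉U]}) · TAIL[D, q∘ch, lv, a[u ↦ c U], ∏_{G ·} q, j]`
  — condition on the side gates one at a time (`Quant.prodBernoulli_real_gate_split`); the base case `X = ∅` is p1 g8's identification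
  `real_heavy_eq_tail` with the spare blob made sure.  Every "mixture principle" row of the canonical model (census-1 g13:
  `Quant.BlockComb.tail_ge_of_mean_hair`, `tail_ge_of_mean_threePoint`, `tail_ge_of_mean_cherry`) reaches gate coordinates through it;
  the hair is `…QuantFarTreeBlockCombHair.lean` (same seat).
[cite: KozmaNitzan2024, Conjecture 3 (p. 15)] (the gluing rows served); the identity is [this work].
-/

noncomputable section

namespace Summit.CriticalPhenomena.PercolationContinuityZ3.Theorems

namespace Quant

open Finset MeasureTheory
open Literature.Probability.LatticeModels
open Literature.Probability.Percolation
open scoped Classical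

namespace BlockCombGate

variable {E : Type*} [Fintype E] [DecidableEq E] {κ : Type*} [Fintype κ] [DecidableEq κ]

/-- product weight of a set of open blobs (canonical model of `…QuantBlockCombMergeModel`) -/
local notation3 "wt[" g ", " S "]" => ∏ k, (if k ∈ (S : Finset κ) then (g : κ → ℝ) k else 1 - (g : κ → ℝ) k)
/-- depth law of the chain -/
local notation3 "pd[" D ", " q ", " i "]" =>
  (∏ i' ∈ Finset.range (i : ℕ), (q : ℕ → ℝ) i') * (if (i : ℕ) < (D : ℕ) then 1 - (q : ℕ → ℝ) i else 1)
/-- mass counted at depth `i` -/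
local notation3 "mass[" lv ", " a ", " i ", " S "]" =>
  ∑ k ∈ (S : Finset κ).filter (fun k => (lv : κ → ℕ) k ≤ (i : ℕ)), ((a : κ → ℕ) k : ℕ)
/-- the canonical tail -/
local notation3 "TAIL[" D ", " q ", " lv ", " a ", " g ", " j "]" =>
  ∑ i ∈ Finset.range ((D : ℕ) + 1), pd[D, q, i] *
    ∑ S : Finset κ, wt[g, S] * (if (j : ℕ) + 1 ≤ mass[lv, a, i, S] then (1 : ℝ) else 0)

/-! ### 1. The mixing identity for a side structure -/

omit [Fintype κ] in
/-- Book-keeping of the spare index: with `a u = 0`, summing `a[u ↦ h]` over a set of blobs adds `h` exactly when `u` is in the set.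
[folklore] -/
theorem sum_update_spare (a : κ → ℕ) (u : κ) (hau : a u = 0) (h : ℕ) (s : Finset κ) :
    ∑ k ∈ s, Function.update a u h k = (∑ k ∈ s, a k) + (if u ∈ s then h else 0) := by
  by_cases hu : u ∈ s
  · rw [if_pos hu, Finset.sum_update_of_mem hu, Finset.sum_eq_add_sum_sdiff_singleton_of_mem hu a, hau, zero_add, add_comm]
  · rw [if_neg hu, add_zero]
    exact Finset.sum_congr rfl fun k hk => by rw [Function.update_of_ne (ne_of_mem_of_not_mem hk hu)]

/-- **THE MIXING IDENTITY for a side structure (gate coordinates).**  Chain `ch` (injective), blobs `G` (pairwise disjoint, off the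
chain), levels `lv ≤ D`, sizes `a`, a spare index `u` with `G u = ∅`, `a u = 0` (level `l = lv u`); a side structure: a finite gate set `X`
off the chain and the blobs with a count `c : Set E → ℕ` depending on the configuration only through the gates of `X`, contributing `c ω`
relays when the chain prefix of length `l` is open.  Then
`P(Σ_{k reached} a k + side count ≥ j+1) = Σ_{U ⊆ X} w_X(U) · TAIL[D, q ∘ ch, lv, a[u ↦ c U], ∏_{G ·} q, j]`,
`w_X(U) = ∏_{e∈X} (q e if e ∈ U else 1 − q e)`.  Induction on `X`: condition on one side gate (`Quant.prodBernoulli_real_gate_split`);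
`X = ∅` is p1 g8's `real_heavy_eq_tail` with the spare blob made sure of size `c ∅`. [this work] -/
theorem real_heavy_side_eq_sum (D : ℕ) (q : E → unitInterval) (ch : Fin D → E) (hch : Function.Injective ch)
    (G : κ → Finset E) (hGdisj : ∀ k k', k ≠ k' → Disjoint (G k) (G k')) (hGch : ∀ k (i : Fin D), ch i ∉ G k)
    (lv : κ → ℕ) (hlv : ∀ k, lv k ≤ D) (a : κ → ℕ) (j : ℕ) (u : κ) (hGu : G u = ∅) (hau : a u = 0) :
    ∀ (X : Finset E), (∀ i : Fin D, ch i ∉ X) → (∀ k, Disjoint X (G k)) →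
    ∀ (c : Set E → ℕ), (∀ ω ω' : Set E, (∀ x ∈ X, (x ∈ ω ↔ x ∈ ω')) → c ω = c ω') →
    (prodBernoulli q).real {ω : Set E | j + 1 ≤ (∑ k ∈ Finset.univ.filter
        (fun k => (∀ i : Fin D, (i : ℕ) < lv k → ch i ∈ ω) ∧ ((G k : Finset E) : Set E) ⊆ ω), a k) +
        (if (∀ i : Fin D, (i : ℕ) < lv u → ch i ∈ ω) then c ω else 0)} =
      ∑ U ∈ X.powerset, (∏ e ∈ X, (if e ∈ U then ((q e : unitInterval) : ℝ) else 1 - (q e : ℝ))) *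
        TAIL[D, (fun i => if h : i < D then ((q (ch ⟨i, h⟩) : unitInterval) : ℝ) else 1), lv,
          Function.update a u (c (U : Set E)), (fun k => ∏ e ∈ G k, (q e : ℝ)), j] := by
  intro X
  induction X using Finset.induction_on with
  | empty =>
    intro _ _ c hc
    rw [Finset.powerset_empty, Finset.sum_singleton, Finset.prod_empty, one_mul]
    have hconst : ∀ ω : Set E, c ω = c ((∅ : Finset E) : Set E) :=
      fun ω => hc ω _ fun x hx => absurd hx (Finset.notMem_empty x)
    -- the side count is the spare blob made sure of size `c ∅`
    have hev : {ω : Set E | j + 1 ≤ (∑ k ∈ Finset.univ.filter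
        (fun k => (∀ i : Fin D, (i : ℕ) < lv k → ch i ∈ ω) ∧ ((G k : Finset E) : Set E) ⊆ ω), a k) +
        (if (∀ i : Fin D, (i : ℕ) < lv u → ch i ∈ ω) then c ω else 0)} =
        {ω : Set E | j + 1 ≤ ∑ k ∈ Finset.univ.filter
          (fun k => (∀ i : Fin D, (i : ℕ) < lv k → ch i ∈ ω) ∧ ((G k : Finset E) : Set E) ⊆ ω),
            Function.update a u (c ((∅ : Finset E) : Set E)) k} := by
      ext ω
      simp only [Set.mem_setOf_eq]
      rw [sum_update_spare a u hau _, hconst ω]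
      have hiff : u ∈ Finset.univ.filter
          (fun k => (∀ i : Fin D, (i : ℕ) < lv k → ch i ∈ ω) ∧ ((G k : Finset E) : Set E) ⊆ ω) ↔
          (∀ i : Fin D, (i : ℕ) < lv u → ch i ∈ ω) := by
        simp only [Finset.mem_filter, Finset.mem_univ, true_and, hGu, Finset.coe_empty, Set.empty_subset, and_true]
      by_cases hpre : ∀ i : Fin D, (i : ℕ) < lv u → ch i ∈ ω
      · rw [if_pos hpre, if_pos (hiff.2 hpre)]
      · rw [if_neg hpre, if_neg (fun h => hpre (hiff.1 h))]
    rw [hev]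
    exact real_heavy_eq_tail D q ch hch G hGdisj hGch lv hlv (Function.update a u (c ((∅ : Finset E) : Set E))) j
  | insert e X' heX' ih =>
    intro hchX hGX c hc
    have hche : ∀ i : Fin D, ch i ≠ e := fun i h => hchX i (h ▸ Finset.mem_insert_self e X')
    have hchX' : ∀ i : Fin D, ch i ∉ X' := fun i h => hchX i (Finset.mem_insert_of_mem h)
    have heG : ∀ k, e ∉ G k := fun k h => Finset.disjoint_left.1 (hGX k) (Finset.mem_insert_self e X') h
    have hGX' : ∀ k, Disjoint X' (G k) :=
      fun k => Finset.disjoint_of_subset_left (Finset.subset_insert e X') (hGX k)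
    -- the two conditioned counts are local on `X'`
    have hc1 : ∀ ω ω' : Set E, (∀ x ∈ X', (x ∈ ω ↔ x ∈ ω')) → c (insert e ω) = c (insert e ω') := by
      intro ω ω' h
      refine hc _ _ fun x hx => ?_
      rw [Set.mem_insert_iff, Set.mem_insert_iff]
      rcases Finset.mem_insert.1 hx with rfl | hx'
      · simp
      · rw [h x hx']
    have hc0 : ∀ ω ω' : Set E, (∀ x ∈ X', (x ∈ ω ↔ x ∈ ω')) → c (ω \ {e}) = c (ω' \ {e}) := by
      intro ω ω' h
      refine hc _ _ fun x hx => ?_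
      rw [Set.mem_sdiff_singleton, Set.mem_sdiff_singleton]
      rcases Finset.mem_insert.1 hx with rfl | hx'
      · simp
      · rw [h x hx']
    set H : Set (Set E) := {ω : Set E | j + 1 ≤ (∑ k ∈ Finset.univ.filter
        (fun k => (∀ i : Fin D, (i : ℕ) < lv k → ch i ∈ ω) ∧ ((G k : Finset E) : Set E) ⊆ ω), a k) +
        (if (∀ i : Fin D, (i : ℕ) < lv u → ch i ∈ ω) then c ω else 0)} with hH
    have hdet : DeterminedBy H (↑(Finset.univ : Finset E) : Set E) := by
      rw [determinedBy_iff]; intro ω ω' h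
      simp only [Finset.coe_univ, Set.inter_univ] at h; rw [h]
    -- reached blobs and the chain prefix do not see the side gate `e`
    have hreach_ins : ∀ (ω : Set E) (k : κ),
        ((∀ i : Fin D, (i : ℕ) < lv k → ch i ∈ insert e ω) ∧ ((G k : Finset E) : Set E) ⊆ insert e ω) ↔
          ((∀ i : Fin D, (i : ℕ) < lv k → ch i ∈ ω) ∧ ((G k : Finset E) : Set E) ⊆ ω) := by
      intro ω k
      refine Iff.and (forall_congr' fun i => imp_congr_right fun _ => ?_) ?_
      · rw [Set.mem_insert_iff, or_iff_right (hche i)]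
      · constructor
        · intro h x hx
          rcases Set.mem_insert_iff.1 (h hx) with h1 | h1
          · exact absurd (Finset.mem_coe.1 hx) (h1 ▸ heG k)
          · exact h1
        · exact fun h x hx => Set.mem_insert_of_mem _ (h hx)
    have hreach_del : ∀ (ω : Set E) (k : κ),
        ((∀ i : Fin D, (i : ℕ) < lv k → ch i ∈ ω \ {e}) ∧ ((G k : Finset E) : Set E) ⊆ ω \ {e}) ↔
          ((∀ i : Fin D, (i : ℕ) < lv k → ch i ∈ ω) ∧ ((G k : Finset E) : Set E) ⊆ ω) := by
      intro ω k
      refine Iff.and (forall_congr' fun i => imp_congr_right fun _ => ?_) ?_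
      · rw [Set.mem_sdiff_singleton, and_iff_left (hche i)]
      · constructor
        · exact fun h x hx => (h hx).1
        · intro h x hx
          exact ⟨h hx, fun h1 => heG k ((Set.mem_singleton_iff.1 h1) ▸ Finset.mem_coe.1 hx)⟩
    have hpre_ins : ∀ ω : Set E, (∀ i : Fin D, (i : ℕ) < lv u → ch i ∈ insert e ω) ↔
        (∀ i : Fin D, (i : ℕ) < lv u → ch i ∈ ω) := fun ω =>
      forall_congr' fun i => imp_congr_right fun _ => by rw [Set.mem_insert_iff, or_iff_right (hche i)]
    have hpre_del : ∀ ω : Set E, (∀ i : Fin D, (i : ℕ) < lv u → ch i ∈ ω \ {e}) ↔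
        (∀ i : Fin D, (i : ℕ) < lv u → ch i ∈ ω) := fun ω =>
      forall_congr' fun i => imp_congr_right fun _ => by rw [Set.mem_sdiff_singleton, and_iff_left (hche i)]
    -- the two conditioned events are side events over `X'`
    have hopen : {ω : Set E | insert e ω ∈ H} = {ω : Set E | j + 1 ≤ (∑ k ∈ Finset.univ.filter
        (fun k => (∀ i : Fin D, (i : ℕ) < lv k → ch i ∈ ω) ∧ ((G k : Finset E) : Set E) ⊆ ω), a k) +
        (if (∀ i : Fin D, (i : ℕ) < lv u → ch i ∈ ω) then (fun ω' => c (insert e ω')) ω else 0)} := by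
      ext ω
      simp only [hH, Set.mem_setOf_eq]
      apply Iff.of_eq
      congr 2
      · refine Finset.sum_congr ?_ fun _ _ => rfl
        ext k
        simp only [Finset.mem_filter, Finset.mem_univ, true_and]
        exact hreach_ins ω k
      · by_cases hp : ∀ i : Fin D, (i : ℕ) < lv u → ch i ∈ ω
        · rw [if_pos ((hpre_ins ω).2 hp), if_pos hp]
        · rw [if_neg (fun h => hp ((hpre_ins ω).1 h)), if_neg hp]
    have hclosed : {ω : Set E | ω \ {e} ∈ H} = {ω : Set E | j + 1 ≤ (∑ k ∈ Finset.univ.filter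
        (fun k => (∀ i : Fin D, (i : ℕ) < lv k → ch i ∈ ω) ∧ ((G k : Finset E) : Set E) ⊆ ω), a k) +
        (if (∀ i : Fin D, (i : ℕ) < lv u → ch i ∈ ω) then (fun ω' => c (ω' \ {e})) ω else 0)} := by
      ext ω
      simp only [hH, Set.mem_setOf_eq]
      apply Iff.of_eq
      congr 2
      · refine Finset.sum_congr ?_ fun _ _ => rfl
        ext k
        simp only [Finset.mem_filter, Finset.mem_univ, true_and]
        exact hreach_del ω k
      · by_cases hp : ∀ i : Fin D, (i : ℕ) < lv u → ch i ∈ ω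
        · rw [if_pos ((hpre_del ω).2 hp), if_pos hp]
        · rw [if_neg (fun h => hp ((hpre_del ω).1 h)), if_neg hp]
    -- condition on the gate `e`
    have hsplit := prodBernoulli_real_gate_split q e H
    rw [prodBernoulli_real_update_one_eq hdet q (Finset.mem_univ e),
      prodBernoulli_real_update_zero_eq hdet q (Finset.mem_univ e), hopen, hclosed,
      ih hchX' hGX' (fun ω' => c (insert e ω')) hc1, ih hchX' hGX' (fun ω' => c (ω' \ {e})) hc0] at hsplit
    rw [hsplit, Finset.sum_powerset_insert heX', add_comm, Finset.mul_sum, Finset.mul_sum]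
    congr 1
    · refine Finset.sum_congr rfl fun U hU => ?_
      have heU : e ∉ U := fun h => heX' (Finset.mem_powerset.1 hU h)
      have hUe : ((U : Finset E) : Set E) \ {e} = (U : Set E) :=
        Set.sdiff_singleton_eq_self fun h => heU (Finset.mem_coe.1 h)
      rw [Finset.prod_insert heX', if_neg heU, mul_assoc, hUe]
    · refine Finset.sum_congr rfl fun U _ => ?_
      rw [Finset.prod_insert heX', if_pos (Finset.mem_insert_self e U), mul_assoc, Finset.coe_insert]
      congr 2
      exact Finset.prod_congr rfl fun x hx =>
        if_congr (Finset.mem_insert.trans (or_iff_right (ne_of_mem_of_not_mem hx heX'))).symm rfl rfl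

end BlockCombGate

end Quant

end Summit.CriticalPhenomena.PercolationContinuityZ3.Theorems

end
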